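import Summits.QuantumFields.YangMills.Theorems.UnitScaleTiltFluctuationComparisonRegPrLevelCauchyMin
import Literature.MathematicalPhysics.QuantumFieldTheory.Balaban1983to89.T3AlphaInputsACTwoRunLevel
import HarnessLib

/-!
# Crux `FluctuationComparisonRegPrL` (stmt-QuantumFields-19935), line v5h STUB 3′ conjuncts (B) ∧ (C): S-E″ FROM THE COARSE-FIELD-INDEXED TERM SOCKETS
# `PintDecompTrivT ∧ TwoRunMinT` (`T3AlphaInputsACTwoRunLevel` §4) — pure counting, the lane's data model
# (support file `--supports stmt-QuantumFields-19935`; nothing registered changes)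

Fleet seat `ym-ust-19201-p2` (gen 4, socket pen).  WHY.  The registered STUB 3′ `stub_alphaTwoRunOfLane` concludes `∃ D, RepAtHeights D … ∧ PintDecomp D ∧
TwoRunMin D …` with the interaction TERMS read as fine-field functionals at the composite minimiser, `Pterm K i Y (Umin K j triv W)`.  The lane `pub-balaban3d`
carries its (43)-terms indexed by (history, coarse field) (★alpha-1 F-α1-5; `Carriers.StepSeries.oldVal/PY/PYZ/act`, minimiser dependence inside the chart data),
so `PintDecomp`/`TwoRunMin` as typed have no honest lane instance, while `Umin` is otherwise unconstrained in STUB 3′ (the factorisation carries no force).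
The Literature append `T3AlphaInputsACTwoRunLevel` §4 states the same sockets over an arbitrary term function `PT : TermFn F` (`ptermMin D` recovers the old
ones, `Iff.rfl`).  THIS FILE re-derives the whole S-E″ consumer chain on the new names, proof for proof:

* `levelDataT D PT K j n V` — the step-`j` part of `PintH D K n V` over `PT`; `PintH_eq_sum_levelDataT` (⇐ `PintDecompTrivT`); `cauchyAtHeights_of_levelwiseT`
  (∘ `LogComparisonSocketLevels.pintCauchyAt_of_levelwise`, p450868);
* `levelCauchyAt_of_polymerwiseT` — `LocMatched D → PolymerCauchyAtT D PT b₀ p₀ m → LevelCauchyAt F γ b₀ p₀ m (levelDataT D PT)` (p458947's proof);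
* `polymerCauchyAtT_of_twoRunMinT` — `TwoRunMinT D PT b₀ p₀ a → PolymerCauchyAtT D PT b₀ p₀ m` for `m > (3+b)/b`, `b = min(a,1)`, every `K` (p479105's counting
  proof over `LogComparisonPolymerBudget`, p476005);
* **`cauchyAtHeights_of_twoRunMinT`**, **`levelCauchyOfTwoRunMinT_dec`** — the S-E″ slot in the registered quantifier shape with hypotheses
  `PintDecompTrivT D PT → TwoRunMinT D PT b₀ p₀ a` (the by-name `landed_…` row of a re-cut STUB 3′ `∃ D PT, RepAtHeights D … ∧ PintDecompTrivT D PT ∧ TwoRunMinT D PT …`);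
* conservativity: at `PT := ptermMin D` the hypotheses are the landed ones (`pintDecompTrivT_ptermMin_of_pintDecomp`, `twoRunMinT_ptermMin_iff`, §4 of the
  Literature module), so p479478's `cauchyAtHeights_of_twoRunMin` is the `ptermMin` instance of `cauchyAtHeights_of_twoRunMinT` (not restated here).
WHAT THIS IS NOT: no estimate of Bałaban's or King's is asserted; every analytic input is a hypothesis schema delivered with the constructed datum.

References: C. King, CMP 102 (1986) 649–677 [King1986] (Thm 3.4 (3.9) p.656, (3.12)–(3.13) p.657, Props. 3.8–3.9 pp.664–665, p.675); T. Bałaban, CMP 102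
(1985) 255–275 [Balaban1985UV3] ((43)–(46) pp.266–267).
-/

noncomputable section

open MeasureTheory Filter Topology
open Literature.MathematicalPhysics.QuantumFieldTheory.Balaban1983to89
open Literature.MathematicalPhysics.QuantumFieldTheory.Balaban1983to89.T3ContinuumYM3Torus
open Literature.MathematicalPhysics.QuantumFieldTheory.Balaban1983to89.T3LevelShift
open Literature.MathematicalPhysics.QuantumFieldTheory.Balaban1983to89.T3UnitLawDensityEML (ℰp measurableE_ℰp)
open Literature.MathematicalPhysics.QuantumFieldTheory.Balaban1983to89.T3UnitScaleTilt
open Literature.MathematicalPhysics.QuantumFieldTheory.Balaban1983to89.T3TiltDescent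
open Literature.MathematicalPhysics.QuantumFieldTheory.Balaban1983to89.T3PrintedRegularMinimiser
open Literature.MathematicalPhysics.QuantumFieldTheory.Balaban1983to89.T3LogComparisonSocket
open Literature.MathematicalPhysics.QuantumFieldTheory.Balaban1983to89.T3AlphaInputsAC
open Literature.MathematicalPhysics.QuantumFieldTheory.Balaban1983to89.T3AlphaPolymerSocket
open Literature.MathematicalPhysics.QuantumFieldTheory.Balaban1983to89.T3AlphaInputsACTwoRunLevel
open Literature.MathematicalPhysics.QuantumFieldTheory.Balaban1983to89.Missing
open Summit.QuantumFields.YangMills.Theorems.LogComparisonPolymerBudget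

namespace Summit.QuantumFields.YangMills.Theorems.LogComparisonLevelCauchyMinT

variable {F : T3Family} {γ : ℝ} (D : AlphaDataT3 F γ) (PT : TermFn F)

/-! ## §1 The step parts of the height reading over a term function; `CauchyAtHeights` from the level socket -/

/-- **THE STEP-`j` PART OF THE HEIGHT READING OF THE INTERACTION SUM OVER A TERM FUNCTION**: run `K`, comparison height `n` (`k = K − n` steps), step
`j < k`: the sum over the level-`(1+j)` localisation domains at the trivial history of `PT K (K−n) (1+j) Y` at the datum read up; `0` above the cut-off.
[cite: Balaban1985UV3, (43) p.266] -/
def levelDataT (K j n : ℕ) (V : GaugeField (F.P n) 0 (Matrix.specialUnitaryGroup (Fin 2) ℂ)) : ℝ :=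
  if h : n ≤ K then
    ∑ Y ∈ D.Loc K (K - n) (D.triv K (K - n)) (1 + j),
      PT K (K - n) (1 + j) Y (fieldShift (F.sitesPerDir_eq (m := F.m) (K := K) (j := K - n) (m' := F.m) (K' := n) (j' := 0) (by omega)) V)
  else 0

/-- `levelDataT` at the interface's own term function is gen 0's `levelData` (definitional). [cite: Balaban1985UV3, (43) p.266] -/
theorem levelDataT_ptermMin : levelDataT D (ptermMin D) = LogComparisonSocketLevelsAlpha.levelData D := by
  funext K j n V
  simp only [levelDataT, LogComparisonSocketLevelsAlpha.levelData, ptermMin_apply]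

/-- **THE HEIGHT READING DECOMPOSES BY STEPS**: under `PintDecompTrivT D PT`, `PintH D K n V = Σ_{j<K−n} levelDataT D PT K j n V` for all `K`, `n`, `V`.
[cite: Balaban1985UV3, (43) p.266] -/
theorem PintH_eq_sum_levelDataT (hdec : PintDecompTrivT D PT) (K n : ℕ) (V : GaugeField (F.P n) 0 (Matrix.specialUnitaryGroup (Fin 2) ℂ)) :
    D.PintH K n V = ∑ j ∈ Finset.range (K - n), levelDataT D PT K j n V := by
  by_cases h : n ≤ K
  · rw [D.PintH_of_le h]
    unfold AlphaDataT3.PintTriv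
    rw [hdec, ← Finset.Ico_add_one_right_eq_Icc, Finset.sum_Ico_eq_sum_range, Nat.add_sub_cancel]
    refine Finset.sum_congr rfl fun j _ => ?_
    simp only [levelDataT, dif_pos h]
  · have hK : K - n = 0 := by omega
    simp only [AlphaDataT3.PintH, dif_neg h, hK, Finset.range_zero, Finset.sum_empty]

/-- **`CauchyAtHeights` FROM ITS LEVEL-BY-LEVEL FORM OVER A TERM FUNCTION**: `PintDecompTrivT D PT` and `LevelCauchyAt F γ b₀ p₀ m (levelDataT D PT)` give
`CauchyAtHeights D b₀ p₀ m` (p450868's level socket). [cite: King1986, Thm 3.4 (3.9) p.656] -/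
theorem cauchyAtHeights_of_levelwiseT (hdec : PintDecompTrivT D PT) (b₀ p₀ : ℝ) (m : ℕ)
    (h : LevelCauchyAt F γ b₀ p₀ m (levelDataT D PT)) : CauchyAtHeights D b₀ p₀ m :=
  LogComparisonSocketLevels.pintCauchyAt_of_levelwise F γ b₀ p₀ m (levelDataT D PT) D.PintH
    (fun K n V => PintH_eq_sum_levelDataT D PT hdec K n V) h

/-! ## §2 The level socket from the polymer socket under matched domains -/

/-- **`LevelCauchyAt (levelDataT D PT)` FROM `PolymerCauchyAtT D PT` UNDER MATCHED LOCALISATION DOMAINS** (per-step budgets `Σ_Y η K j Y`, shifts `Σ_Y c K j Y`;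
p458947's proof over `PT`). [cite: King1986, Prop. 3.8-3.9 pp.664-665] -/
theorem levelCauchyAt_of_polymerwiseT (b₀ p₀ : ℝ) (m : ℕ) (hmatch : LocMatched D) (h : PolymerCauchyAtT D PT b₀ p₀ m) :
    LevelCauchyAt F γ b₀ p₀ m (levelDataT D PT) := by
  obtain ⟨η, c, δ₀, c₀, hη, hδ₀, hS, hextra, hmatched⟩ := h
  refine ⟨fun K j => ∑ Y ∈ D.Loc K (K - K / m) (D.triv K (K - K / m)) (1 + j), η K j Y,
    fun K j => ∑ Y ∈ D.Loc K (K - K / m) (D.triv K (K - K / m)) (1 + j), c K j Y, δ₀, c₀,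
    fun K j => Finset.sum_nonneg fun Y _ => hη K j Y, hδ₀, hS, fun K => ?_, fun K j hj => ?_⟩
  · filter_upwards [hextra K] with V hV hs h0 h0'
    have hle : K / m ≤ K + 1 := (Nat.div_le_self K m).trans (Nat.le_succ K)
    have hld : levelDataT D PT (K + 1) 0 (K / m) V =
        ∑ Y ∈ D.Loc (K + 1) (K + 1 - K / m) (D.triv (K + 1) (K + 1 - K / m)) 1,
          PT (K + 1) (K + 1 - K / m) 1 Y
            (fieldShift (F.sitesPerDir_eq (m := F.m) (K := K + 1) (j := K + 1 - K / m) (m' := F.m) (K' := K / m) (j' := 0) (by omega)) V) := by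
      simp only [levelDataT, dif_pos hle]
    rw [hld]
    exact hV hs h0 h0'
  · have hdl : K / m ≤ K := Nat.div_le_self K m
    have hle : K / m ≤ K + 1 := hdl.trans (Nat.le_succ K)
    set LocK := D.Loc K (K - K / m) (D.triv K (K - K / m)) (1 + j) with hLocK
    have hall : ∀ᵐ V ∂fieldMeasure (F.P (K / m)) 0 (Matrix.specialUnitaryGroup (Fin 2) ℂ), ∀ Y ∈ LocK,
        PlaqSmall (θBal F.L γ b₀ p₀ (K / m)) V →
          0 < heightDensity F γ (Nat.div_le_self K m) (histGood F ℰp (θBal F.L γ b₀ p₀) K (K / m)) V →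
          0 < heightDensity F γ ((Nat.div_le_self K m).trans (Nat.le_succ K))
                (histGood F ℰp (θBal F.L γ b₀ p₀) (K + 1) (K / m)) V →
            |PT (K + 1) (K + 1 - K / m) (1 + (j + 1)) (refineSet F K Y)
                (fieldShift (F.sitesPerDir_eq (m := F.m) (K := K + 1) (j := K + 1 - K / m) (m' := F.m) (K' := K / m) (j' := 0) (by omega)) V) -
              PT K (K - K / m) (1 + j) Y
                (fieldShift (F.sitesPerDir_eq (m := F.m) (K := K) (j := K - K / m) (m' := F.m) (K' := K / m) (j' := 0) (by omega)) V) -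
              c K j Y| ≤ η K j Y :=
      (Filter.eventually_all_finset LocK).mpr fun Y hY => hmatched K j hj Y hY
    filter_upwards [hall] with V hV hs h0 h0'
    have hbij := hmatch K (K / m) hdl (1 + j) (by omega) (by omega)
    have hldK : levelDataT D PT K j (K / m) V = ∑ Y ∈ LocK, PT K (K - K / m) (1 + j) Y
        (fieldShift (F.sitesPerDir_eq (m := F.m) (K := K) (j := K - K / m) (m' := F.m) (K' := K / m) (j' := 0) (by omega)) V) := by
      simp only [levelDataT, dif_pos hdl, hLocK]
    have hldK1 : levelDataT D PT (K + 1) (j + 1) (K / m) V =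
        ∑ Y' ∈ D.Loc (K + 1) (K + 1 - K / m) (D.triv (K + 1) (K + 1 - K / m)) (1 + (j + 1)),
          PT (K + 1) (K + 1 - K / m) (1 + (j + 1)) Y'
            (fieldShift (F.sitesPerDir_eq (m := F.m) (K := K + 1) (j := K + 1 - K / m) (m' := F.m) (K' := K / m) (j' := 0) (by omega)) V) := by
      simp only [levelDataT, dif_pos hle]
    have hsum : ∑ Y' ∈ D.Loc (K + 1) (K + 1 - K / m) (D.triv (K + 1) (K + 1 - K / m)) (1 + (j + 1)),
          PT (K + 1) (K + 1 - K / m) (1 + (j + 1)) Y'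
            (fieldShift (F.sitesPerDir_eq (m := F.m) (K := K + 1) (j := K + 1 - K / m) (m' := F.m) (K' := K / m) (j' := 0) (by omega)) V) =
        ∑ Y ∈ LocK, PT (K + 1) (K + 1 - K / m) (1 + (j + 1)) (refineSet F K Y)
            (fieldShift (F.sitesPerDir_eq (m := F.m) (K := K + 1) (j := K + 1 - K / m) (m' := F.m) (K' := K / m) (j' := 0) (by omega)) V) := by
      symm
      exact Finset.sum_nbij (refineSet F K) (fun Y hY => hbij.mapsTo hY) (fun Y₁ h₁ Y₂ h₂ h12 => hbij.injOn h₁ h₂ h12)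
        (fun Y' hY' => hbij.surjOn hY') (fun Y _ => rfl)
    rw [hldK, hldK1, hsum, ← Finset.sum_sub_distrib, ← Finset.sum_sub_distrib]
    exact (Finset.abs_sum_le_sum_abs _ _).trans (Finset.sum_le_sum fun Y hY => hV Y hY hs h0 h0')

/-! ## §3 The polymer socket from the folded bundle over a term function (pure counting) -/

/-- **THE POLYMER SOCKET FROM THE FOLDED BUNDLE OVER A TERM FUNCTION** (S-E″, pure counting): for `1 < L`, `0 < γ ≤ 1`, `0 < b₀`, `0 < p₀`, `0 < a` and
`m > (3+b)/b`, `b = min(a,1)`, `TwoRunMinT D PT b₀ p₀ a` gives `PolymerCauchyAtT D PT b₀ p₀ m` — per-polymer budgets `C⁺e^{−κ₁𝓛(Y)}Θ²L^{−4(K−⌊K/m⌋−1−j)}(L^{−(1+j)})^{b}`,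
the folded comparison's shifts, extra slice `Σ_Y C⁺e^{−κ₁𝓛}Θ²L^{−4k}` from `TermSizeTrivT` at run `K+1`, `c₀ = 0`; summability by p476005's majorant for every `K`
(p479105's proof over `PT`). [cite: King1986, Thm 3.4 (3.9) p.656 and (3.12)-(3.13) p.657] -/
theorem polymerCauchyAtT_of_twoRunMinT {b₀ p₀ a : ℝ} {m : ℕ}
    (hL : 1 < F.L) (hγ : 0 < γ) (hγ1 : γ ≤ 1) (hb : 0 < b₀) (hp : 0 < p₀) (ha : 0 < a)
    (hm : (3 + min a 1) / min a 1 < (m : ℝ)) (hTR : TwoRunMinT D PT b₀ p₀ a) :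
    PolymerCauchyAtT D PT b₀ p₀ m := by
  classical
  obtain ⟨κ₁, ⟨Cts, hTS⟩, ⟨C', hLC⟩, hBV, hLM, ⟨Cp, c, hMin⟩⟩ := hTR
  set b : ℝ := min a 1 with hbdef
  have hb0 : 0 < b := lt_min ha one_pos
  have hb1 : b ≤ 1 := min_le_right _ _
  have hba : b ≤ a := min_le_left _ _
  have hm0r : (0 : ℝ) < m := lt_trans (by positivity) hm
  have hm0 : 0 < m := by exact_mod_cast hm0r
  have hc0 : 0 < b - (3 + b) / m := by
    have : (3 + b) / (m : ℝ) < b := by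
      rw [div_lt_iff₀ hm0r]
      have := (div_lt_iff₀ hb0).mp hm
      linarith
    linarith
  have hLr : (1 : ℝ) < (F.L : ℝ) := by exact_mod_cast hL
  have hL0 : (0 : ℝ) < (F.L : ℝ) := by linarith
  obtain ⟨hr0, hr1⟩ := rpow_neg_lt_one hLr hc0
  obtain ⟨Θ, hΘdef⟩ : ∃ Θ : ℝ, Θ = b₀ * ((2 * p₀) ^ p₀ * Real.exp (1 / 2 - p₀)) * Real.sqrt (Real.sqrt γ) := ⟨_, rfl⟩
  have hθΘ : ∀ i, θBal F.L γ b₀ p₀ i ≤ Θ := fun i => by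
    rw [hΘdef]; exact T3Thresholds.θBal_le_const_mul_rpow hL.le hγ hγ1 hb.le hp i
  have hθ0 : ∀ i, 0 < θBal F.L γ b₀ p₀ i := T3MinimiserStabilityReduction.θBal_pos hL.le hγ hγ1 hb p₀
  have hΘ0 : 0 ≤ Θ := (hθ0 0).le.trans (hθΘ 0)
  obtain ⟨M₀, hM₀def⟩ : ∃ M₀ : ℝ, M₀ = max Cp 0 * Θ ^ 2 := ⟨_, rfl⟩
  have hM₀ : 0 ≤ M₀ := by rw [hM₀def]; positivity
  obtain ⟨η, hη⟩ : ∃ η : (K j : ℕ) → Set (Site (F.P K) 0) → ℝ, ∀ K j Y, η K j Y =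
      M₀ * Real.exp (-κ₁ * D.treeLen K (1 + j) Y) * (((F.L : ℝ) ^ (K - K / m - 1 - j))⁻¹) ^ 4 * (((F.L : ℝ) ^ (1 + j))⁻¹) ^ b :=
    ⟨_, fun _ _ _ => rfl⟩
  obtain ⟨δ₀, hδ₀⟩ : ∃ δ₀ : ℕ → ℝ, ∀ K, δ₀ K = ∑ Y ∈ D.Loc (K + 1) (K + 1 - K / m) (D.triv (K + 1) (K + 1 - K / m)) 1,
      max Cts 0 * Real.exp (-κ₁ * D.treeLen (K + 1) 1 Y) * Θ ^ 2 * (((F.L : ℝ) ^ (K - K / m))⁻¹) ^ 4 :=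
    ⟨_, fun _ => rfl⟩
  have hη0 : ∀ K j Y, 0 ≤ η K j Y := fun K j Y => by rw [hη]; positivity
  have hδ₀0 : ∀ K, 0 ≤ δ₀ K := fun K => by rw [hδ₀]; exact Finset.sum_nonneg fun Y _ => by positivity
  refine ⟨η, fun K j Y => c K (K / m) j Y, δ₀, fun _ => 0, hη0, hδ₀0, ?_, fun K => ?_, fun K j hj Y hY => ?_⟩
  · have hA : 0 ≤ 8 * max Cts 0 * max C' 0 * Θ ^ 2 * (F.L : ℝ) ^ (3 * F.m) := by positivity
    have hB : 0 ≤ 8 * M₀ * max C' 0 * (F.L : ℝ) ^ (3 * F.m) := by positivity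
    have hbound : ∀ K,
        δ₀ K + ∑ j ∈ Finset.range (K - K / m), ∑ Y ∈ D.Loc K (K - K / m) (D.triv K (K - K / m)) (1 + j), η K j Y ≤
          (8 * max Cts 0 * max C' 0 * Θ ^ 2 * (F.L : ℝ) ^ (3 * F.m) + 8 * M₀ * max C' 0 * (F.L : ℝ) ^ (3 * F.m)) * ((K : ℝ) + 1) *
            ((F.L : ℝ) ^ (-(b - (3 + b) / m))) ^ K := by
      intro K
      have hsum : ∑ j ∈ Finset.range (K - K / m), ∑ Y ∈ D.Loc K (K - K / m) (D.triv K (K - K / m)) (1 + j), η K j Y =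
          ∑ j ∈ Finset.range (K - K / m), ∑ Y ∈ D.Loc K (K - K / m) (D.triv K (K - K / m)) (1 + j),
            M₀ * Real.exp (-κ₁ * D.treeLen K (1 + j) Y) * (((F.L : ℝ) ^ (K - K / m - 1 - j))⁻¹) ^ 4 * (((F.L : ℝ) ^ (1 + j))⁻¹) ^ b :=
        Finset.sum_congr rfl fun j _ => Finset.sum_congr rfl fun Y _ => by rw [hη]
      rw [hsum, hδ₀]
      have hn : K / m ≤ K := Nat.div_le_self K m
      have hex := extra_budget_le D hLC hBV (C := max Cts 0) (Θ := Θ) (le_max_right _ _) hb1 hn (D.triv (K + 1) (K + 1 - K / m))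
      have hma := matched_budget_le D hLC hBV hM₀ hb1 hn (D.triv K (K - K / m))
      have hdec := rpow_free_fraction_le hLr hb0.le hm0 K
      have hkK : ((K - K / m : ℕ) : ℝ) ≤ (K : ℝ) + 1 := by
        have : ((K - K / m : ℕ) : ℝ) ≤ K := by exact_mod_cast Nat.sub_le K (K / m)
        linarith
      have hK1 : (1 : ℝ) ≤ (K : ℝ) + 1 := by have : (0 : ℝ) ≤ K := Nat.cast_nonneg K; linarith
      have he0 : 0 ≤ (F.L : ℝ) ^ ((3 * (K / m : ℕ) - b * (K - K / m : ℕ) : ℝ)) := Real.rpow_nonneg hL0.le _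
      refine (add_le_add hex hma).trans ?_
      have hAe : 8 * max Cts 0 * max C' 0 * Θ ^ 2 * (F.L : ℝ) ^ (3 * F.m) * (F.L : ℝ) ^ ((3 * (K / m : ℕ) - b * (K - K / m : ℕ) : ℝ)) ≤
          ((K : ℝ) + 1) * (8 * max Cts 0 * max C' 0 * Θ ^ 2 * (F.L : ℝ) ^ (3 * F.m) * ((F.L : ℝ) ^ (-(b - (3 + b) / m))) ^ K) := by
        have h1 : 8 * max Cts 0 * max C' 0 * Θ ^ 2 * (F.L : ℝ) ^ (3 * F.m) * (F.L : ℝ) ^ ((3 * (K / m : ℕ) - b * (K - K / m : ℕ) : ℝ)) ≤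
            8 * max Cts 0 * max C' 0 * Θ ^ 2 * (F.L : ℝ) ^ (3 * F.m) * ((F.L : ℝ) ^ (-(b - (3 + b) / m))) ^ K :=
          mul_le_mul_of_nonneg_left hdec hA
        exact h1.trans (le_mul_of_one_le_left (mul_nonneg hA (pow_nonneg hr0.le K)) hK1)
      have hBe : ((K - K / m : ℕ) : ℝ) * (8 * M₀ * max C' 0 * (F.L : ℝ) ^ (3 * F.m) * (F.L : ℝ) ^ ((3 * (K / m : ℕ) - b * (K - K / m : ℕ) : ℝ))) ≤
          ((K : ℝ) + 1) * (8 * M₀ * max C' 0 * (F.L : ℝ) ^ (3 * F.m) * ((F.L : ℝ) ^ (-(b - (3 + b) / m))) ^ K) :=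
        mul_le_mul hkK (mul_le_mul_of_nonneg_left hdec hB) (mul_nonneg hB he0) (by linarith)
      refine (add_le_add hAe hBe).trans (le_of_eq ?_)
      ring
    have hnn : ∀ K, 0 ≤ δ₀ K + ∑ j ∈ Finset.range (K - K / m), ∑ Y ∈ D.Loc K (K - K / m) (D.triv K (K - K / m)) (1 + j), η K j Y :=
      fun K => add_nonneg (hδ₀0 K) (Finset.sum_nonneg fun j _ => Finset.sum_nonneg fun Y _ => hη0 K j Y)
    exact Summable.of_nonneg_of_le hnn hbound (summable_majorant _ hr0.le hr1)
  · refine ae_of_all _ fun V hV _ _ => ?_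
    rw [sub_zero, hδ₀]
    have hn : K / m ≤ K := Nat.div_le_self K m
    have hn' : K / m ≤ K + 1 := hn.trans (Nat.le_succ K)
    refine (Finset.abs_sum_le_sum_abs _ _).trans (Finset.sum_le_sum fun Y hY => ?_)
    have h1 := hTS.2 (K + 1) (K / m) hn' V hV 1 le_rfl (by omega) Y hY
    refine h1.trans ?_
    have hKK : K + 1 - K / m - 1 = K - K / m := by omega
    rw [hKK]
    have hθ2 : θBal F.L γ b₀ p₀ (K / m + 1) ^ 2 ≤ Θ ^ 2 := pow_le_pow_left₀ (hθ0 _).le (hθΘ _) 2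
    have hX : 0 ≤ Real.exp (-κ₁ * D.treeLen (K + 1) 1 Y) * (((F.L : ℝ) ^ (K - K / m))⁻¹) ^ 4 := by positivity
    calc Cts * Real.exp (-κ₁ * D.treeLen (K + 1) 1 Y) * θBal F.L γ b₀ p₀ (K / m + 1) ^ 2 * (((F.L : ℝ) ^ (K - K / m))⁻¹) ^ 4
        = Cts * θBal F.L γ b₀ p₀ (K / m + 1) ^ 2 * (Real.exp (-κ₁ * D.treeLen (K + 1) 1 Y) * (((F.L : ℝ) ^ (K - K / m))⁻¹) ^ 4) := by ring
      _ ≤ max Cts 0 * Θ ^ 2 * (Real.exp (-κ₁ * D.treeLen (K + 1) 1 Y) * (((F.L : ℝ) ^ (K - K / m))⁻¹) ^ 4) := by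
          refine mul_le_mul_of_nonneg_right ?_ hX
          calc Cts * θBal F.L γ b₀ p₀ (K / m + 1) ^ 2 ≤ max Cts 0 * θBal F.L γ b₀ p₀ (K / m + 1) ^ 2 :=
                mul_le_mul_of_nonneg_right (le_max_left _ _) (by positivity)
            _ ≤ max Cts 0 * Θ ^ 2 := mul_le_mul_of_nonneg_left hθ2 (le_max_right _ _)
      _ = max Cts 0 * Real.exp (-κ₁ * D.treeLen (K + 1) 1 Y) * Θ ^ 2 * (((F.L : ℝ) ^ (K - K / m))⁻¹) ^ 4 := by ring
  · refine ae_of_all _ fun V hV _ _ => ?_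
    rw [hη, hM₀def]
    have hn : K / m ≤ K := Nat.div_le_self K m
    have hest := hMin K (K / m) hn j hj V hV Y hY
    refine hest.trans ?_
    have hx0 : 0 < ((F.L : ℝ) ^ (1 + j))⁻¹ := by positivity
    have hx1 : ((F.L : ℝ) ^ (1 + j))⁻¹ ≤ 1 := inv_le_one_of_one_le₀ (one_le_pow₀ hLr.le)
    have hxa : (((F.L : ℝ) ^ (1 + j))⁻¹) ^ a ≤ (((F.L : ℝ) ^ (1 + j))⁻¹) ^ b := Real.rpow_le_rpow_of_exponent_ge hx0 hx1 hba
    have hθ2 : θBal F.L γ b₀ p₀ (K / m) ^ 2 ≤ Θ ^ 2 := pow_le_pow_left₀ (hθ0 _).le (hθΘ _) 2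
    have h1 : θBal F.L γ b₀ p₀ (K / m) ^ 2 * (((F.L : ℝ) ^ (1 + j))⁻¹) ^ a ≤ Θ ^ 2 * (((F.L : ℝ) ^ (1 + j))⁻¹) ^ b :=
      mul_le_mul hθ2 hxa (Real.rpow_nonneg hx0.le _) (by positivity)
    have hX : 0 ≤ Real.exp (-κ₁ * D.treeLen K (1 + j) Y) * (((F.L : ℝ) ^ (K - K / m - 1 - j))⁻¹) ^ 4 := by positivity
    calc Cp * Real.exp (-κ₁ * D.treeLen K (1 + j) Y) * θBal F.L γ b₀ p₀ (K / m) ^ 2 * (((F.L : ℝ) ^ (K - K / m - 1 - j))⁻¹) ^ 4 *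
          (((F.L : ℝ) ^ (1 + j))⁻¹) ^ a
        = Cp * ((Real.exp (-κ₁ * D.treeLen K (1 + j) Y) * (((F.L : ℝ) ^ (K - K / m - 1 - j))⁻¹) ^ 4) *
            (θBal F.L γ b₀ p₀ (K / m) ^ 2 * (((F.L : ℝ) ^ (1 + j))⁻¹) ^ a)) := by ring
      _ ≤ max Cp 0 * ((Real.exp (-κ₁ * D.treeLen K (1 + j) Y) * (((F.L : ℝ) ^ (K - K / m - 1 - j))⁻¹) ^ 4) *
            (θBal F.L γ b₀ p₀ (K / m) ^ 2 * (((F.L : ℝ) ^ (1 + j))⁻¹) ^ a)) :=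
          mul_le_mul_of_nonneg_right (le_max_left _ _) (mul_nonneg hX (by positivity))
      _ ≤ max Cp 0 * ((Real.exp (-κ₁ * D.treeLen K (1 + j) Y) * (((F.L : ℝ) ^ (K - K / m - 1 - j))⁻¹) ^ 4) *
            (Θ ^ 2 * (((F.L : ℝ) ^ (1 + j))⁻¹) ^ b)) :=
          mul_le_mul_of_nonneg_left (mul_le_mul_of_nonneg_left h1 hX) (le_max_right _ _)
      _ = max Cp 0 * Θ ^ 2 * Real.exp (-κ₁ * D.treeLen K (1 + j) Y) * (((F.L : ℝ) ^ (K - K / m - 1 - j))⁻¹) ^ 4 *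
            (((F.L : ℝ) ^ (1 + j))⁻¹) ^ b := by ring

/-! ## §4 S-E″ from the term-function sockets; the registered-shape slot; conservativity -/

/-- **S-E″ CLOSED FROM THE TERM-FUNCTION SOCKETS** (pure counting): for `1 < L`, `0 < γ ≤ 1`, `0 < b₀`, `0 < p₀`, `0 < a`, `m > (3+b)/b` (`b = min(a,1)`),
`PintDecompTrivT D PT` and `TwoRunMinT D PT b₀ p₀ a` give `CauchyAtHeights D b₀ p₀ m`. [cite: King1986, Thm 3.4 (3.9) p.656] -/
theorem cauchyAtHeights_of_twoRunMinT {b₀ p₀ a : ℝ} {m : ℕ}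
    (hL : 1 < F.L) (hγ : 0 < γ) (hγ1 : γ ≤ 1) (hb : 0 < b₀) (hp : 0 < p₀) (ha : 0 < a)
    (hm : (3 + min a 1) / min a 1 < (m : ℝ)) (hdec : PintDecompTrivT D PT) (hTR : TwoRunMinT D PT b₀ p₀ a) :
    CauchyAtHeights D b₀ p₀ m := by
  have hLM : LocMatched D := by
    obtain ⟨κ₁, -, -, -, hLM, -⟩ := hTR
    exact hLM
  exact cauchyAtHeights_of_levelwiseT D PT hdec b₀ p₀ m
    (levelCauchyAt_of_polymerwiseT D PT b₀ p₀ m hLM (polymerCauchyAtT_of_twoRunMinT D PT hL hγ hγ1 hb hp ha hm hTR))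

/-- **THE S-E″ SLOT OVER THE TERM-FUNCTION SOCKETS — PACKAGE-FREE, REGISTERED QUANTIFIER SHAPE** (the `landed_…` row of a STUB 3′ re-cut concluding
`∃ D PT, RepAtHeights D … ∧ PintDecompTrivT D PT ∧ TwoRunMinT D PT …`): for every `a > 0` (`ε₁ = γ₁ = 1`, `m₀ = ⌈(3+b)/b⌉ + 1`, `b = min(a,1)`),
`PintDecompTrivT D PT` and `TwoRunMinT D PT b₀ p₀ a` give `CauchyAtHeights D b₀ p₀ m`. [cite: King1986, Thm 3.4 (3.9) p.656] -/
theorem levelCauchyOfTwoRunMinT_dec :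
    ∀ (L : ℕ), Odd L → 1 < L → ∀ (a : ℝ), 0 < a →
      ∃ ε₁ : ℝ, 0 < ε₁ ∧ ∀ (ε₀ : ℝ), 0 < ε₀ → ε₀ ≤ ε₁ → ∃ m₀ : ℕ, ∀ (m : ℕ), m₀ ≤ m → ∀ (b₀ p₀ : ℝ), 0 < b₀ → 2 < p₀ →
        ∃ γ₁ : ℝ, 0 < γ₁ ∧ ∀ (F : T3Family) (γ : ℝ), F.L = L → 0 < γ → γ ≤ γ₁ →
          ∀ (D : AlphaDataT3 F γ) (PT : TermFn F), PintDecompTrivT D PT → TwoRunMinT D PT b₀ p₀ a → CauchyAtHeights D b₀ p₀ m := by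
  intro L _ hL a ha
  refine ⟨1, one_pos, fun ε₀ _ _ => ?_⟩
  refine ⟨Nat.ceil ((3 + min a 1) / min a 1) + 1, fun m hm b₀ p₀ hb hp => ?_⟩
  refine ⟨1, one_pos, fun F γ hF hγ hγ1 D PT hdec hTR => ?_⟩
  have hm' : (3 + min a 1) / min a 1 < (m : ℝ) := by
    have h1 := Nat.le_ceil ((3 + min a 1) / min a 1)
    have h2 : ((Nat.ceil ((3 + min a 1) / min a 1) + 1 : ℕ) : ℝ) ≤ m := by exact_mod_cast hm
    push_cast at h2
    linarith
  have hL' : 1 < F.L := by rw [hF]; exact hL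
  exact cauchyAtHeights_of_twoRunMinT D PT hL' hγ hγ1 hb (by linarith) ha hm' hdec hTR

end Summit.QuantumFields.YangMills.Theorems.LogComparisonLevelCauchyMinT

end
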